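import Literature.Probability.LatticeModels.MedialInterface
import Literature.Probability.RandomPlanarGeometry.PlanarDomains
import Mathlib.Topology.MetricSpace.Thickening
import Mathlib.Data.Set.Card
import HarnessLib

/-!
# Metric geometry of a `3`-marked Jordan domain: helper for stub `stub_discreteSplitting` of line
`hitting-tournament` for crux `LagHandOff` (stmt-CriticalPhenomena-10268)

Elementary facts about a Jordan domain with three marked points `x₀, x₁, x₂` and its three closed
boundary arcs `α₀ = [x₀, x₁]`, `α₁ = [x₁, x₂]`, `α₂ = [x₂, x₀]`, consumed by the patching of
labellings (`…DiscreteSplittingPatch.lean`): the arcs of the three chords `(x₀, x₁)`, `(x₀, x₂)`,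
`(x₁, x₂)` in terms of `α₀, α₁, α₂`; the marked points off the opposite arcs; no point is close to
all three arcs; points close to `α₁` and `α₂` are close to `x₂`; and a two-element edge set whose
midpoints are Hausdorff-close to two far-apart points consists of one edge near each.
-/

noncomputable section

open Set Metric Filter Topology
open Literature.Probability.LatticeModels Literature.Probability.RandomPlanarGeometry

namespace Summit.CriticalPhenomena.CardyFormulaZ2.Cruxes.LagHandOff.HittingTournament

/-! ### Arcs of the chords of a `3`-marked domain -/

section Arcs

variable (D : MarkedDomain 3)

/-- The marks of a `3`-marked domain in order, the last one before the first shifted by the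
period. -/
theorem marks_three : D.mark 0 < D.mark 1 ∧ D.mark 1 < D.mark 2 ∧ D.mark 2 < D.mark 0 + 1 :=
  ⟨D.strictMono_mark (by decide), D.strictMono_mark (by decide),
    by linarith [(D.mark_mem 2).2, (D.mark_mem 0).1]⟩

/-- The three arcs `α₀ = [x₀, x₁]`, `α₁ = [x₁, x₂]`, `α₂ = [x₂, x₀]` as images of parameter
intervals. -/
theorem arcs_three : D.arc 0 = D.boundary '' Icc (D.mark 0) (D.mark 1) ∧
    D.arc 1 = D.boundary '' Icc (D.mark 1) (D.mark 2) ∧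
    D.arc 2 = D.boundary '' Icc (D.mark 2) (D.mark 0 + 1) := by
  unfold MarkedDomain.arc MarkedDomain.nextMark; simp

/-- A shift by the period does not change images of the boundary loop. -/
theorem image_boundary_Icc_add_one (s t : ℝ) :
    D.boundary '' Icc (s + 1) (t + 1) = D.boundary '' Icc s t := by
  rw [← image_add_const_Icc, image_image]
  exact image_congr fun x _ => D.periodic_boundary x

/-- The arcs of the chord `(x₀, x₂)`: `[x₀, x₂] = α₀ ∪ α₁` and `[x₂, x₀] = α₂`. -/
theorem arc_chord_zero_two :
    (D.chord 0 2 (by decide)).arc 0 = D.arc 0 ∪ D.arc 1 ∧ (D.chord 0 2 (by decide)).arc 1 = D.arc 2 := by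
  have h0 : (D.chord 0 2 (by decide)).arc 0 = D.boundary '' Icc (D.mark 0) (D.mark 2) := by
    unfold MarkedDomain.arc MarkedDomain.nextMark; simp; rfl
  have h1 : (D.chord 0 2 (by decide)).arc 1 = D.boundary '' Icc (D.mark 2) (D.mark 0 + 1) := by
    unfold MarkedDomain.arc MarkedDomain.nextMark; simp; rfl
  obtain ⟨e0, e1, e2⟩ := arcs_three D
  obtain ⟨m01, m12, -⟩ := marks_three D
  refine ⟨?_, by rw [h1, e2]⟩
  rw [h0, e0, e1, ← image_union, Icc_union_Icc_eq_Icc m01.le m12.le]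

/-- The arcs of the chord `(x₁, x₂)`: `[x₁, x₂] = α₁` and `[x₂, x₁] = α₂ ∪ α₀`. -/
theorem arc_chord_one_two :
    (D.chord 1 2 (by decide)).arc 0 = D.arc 1 ∧ (D.chord 1 2 (by decide)).arc 1 = D.arc 2 ∪ D.arc 0 := by
  have h0 : (D.chord 1 2 (by decide)).arc 0 = D.boundary '' Icc (D.mark 1) (D.mark 2) := by
    unfold MarkedDomain.arc MarkedDomain.nextMark; simp; rfl
  have h1 : (D.chord 1 2 (by decide)).arc 1 = D.boundary '' Icc (D.mark 2) (D.mark 1 + 1) := by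
    unfold MarkedDomain.arc MarkedDomain.nextMark; simp; rfl
  obtain ⟨e0, e1, e2⟩ := arcs_three D
  obtain ⟨m01, -, m20⟩ := marks_three D
  refine ⟨by rw [h0, e1], ?_⟩
  rw [h1, e2, e0, ← image_boundary_Icc_add_one D (D.mark 0) (D.mark 1), ← image_union,
    Icc_union_Icc_eq_Icc m20.le (by linarith)]

/-- The arcs of the chord `(x₀, x₁)`: `[x₀, x₁] = α₀` and `[x₁, x₀] = α₁ ∪ α₂`. -/
theorem arc_chord_zero_one :
    (D.chord 0 1 (by decide)).arc 0 = D.arc 0 ∧ (D.chord 0 1 (by decide)).arc 1 = D.arc 1 ∪ D.arc 2 := by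
  have h0 : (D.chord 0 1 (by decide)).arc 0 = D.boundary '' Icc (D.mark 0) (D.mark 1) := by
    unfold MarkedDomain.arc MarkedDomain.nextMark; simp; rfl
  have h1 : (D.chord 0 1 (by decide)).arc 1 = D.boundary '' Icc (D.mark 1) (D.mark 0 + 1) := by
    unfold MarkedDomain.arc MarkedDomain.nextMark; simp; rfl
  obtain ⟨e0, e1, e2⟩ := arcs_three D
  obtain ⟨-, m12, m20⟩ := marks_three D
  refine ⟨by rw [h0, e0], ?_⟩
  rw [h1, e1, e2, ← image_union, Icc_union_Icc_eq_Icc m12.le m20.le]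

/-! ### Marked points off the opposite arcs; intersections of consecutive arcs -/

/-- Injectivity of the boundary loop over two periods: parameters `s ∈ [0, 1)` and `t ∈ [0, 2)`
with the same image satisfy `s = t` or `s = t - 1`. -/
theorem eq_or_eq_sub_one_of_boundary_eq {s t : ℝ} (hs : s ∈ Ico (0 : ℝ) 1) (ht0 : 0 ≤ t) (ht2 : t < 2)
    (h : D.boundary s = D.boundary t) : s = t ∨ s = t - 1 := by
  rcases lt_or_ge t 1 with ht1 | ht1
  · exact Or.inl (D.injOn_boundary hs ⟨ht0, ht1⟩ h)
  · right
    have h' : D.boundary t = D.boundary (t - 1) := by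
      conv_lhs => rw [show t = t - 1 + 1 by ring]
      exact D.periodic_boundary _
    exact D.injOn_boundary hs ⟨by linarith, by linarith⟩ (h.trans h')

/-- The marked points lie off the opposite arcs: `x₀ ∉ α₁`, `x₂ ∉ α₀`, `x₁ ∉ α₂`. -/
theorem pt_notMem_arcs : D.pt 0 ∉ D.arc 1 ∧ D.pt 2 ∉ D.arc 0 ∧ D.pt 1 ∉ D.arc 2 := by
  obtain ⟨e0, e1, e2⟩ := arcs_three D
  obtain ⟨m01, m12, m20⟩ := marks_three D
  have h0 := D.mark_mem 0; have h1 := D.mark_mem 1; have h2 := D.mark_mem 2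
  refine ⟨?_, ?_, ?_⟩
  · rw [e1]
    rintro ⟨t, ht, h⟩
    rcases eq_or_eq_sub_one_of_boundary_eq D h0 (by linarith [ht.1, h1.1]) (by linarith [ht.2, h2.2])
      h.symm with h' | h' <;> linarith [ht.1, ht.2, h2.2, h0.1]
  · rw [e0]
    rintro ⟨t, ht, h⟩
    rcases eq_or_eq_sub_one_of_boundary_eq D h2 (by linarith [ht.1, h0.1]) (by linarith [ht.2, h1.2])
      h.symm with h' | h' <;> linarith [ht.1, ht.2, h0.1]
  · rw [e2]
    rintro ⟨t, ht, h⟩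
    rcases eq_or_eq_sub_one_of_boundary_eq D h1 (by linarith [ht.1, h2.1]) (by linarith [ht.2, h0.2])
      h.symm with h' | h' <;> linarith [ht.1, ht.2]

/-- Consecutive arcs meet only at the marked point between them: `α₁ ∩ α₂ ⊆ {x₂}`. -/
theorem arc_one_inter_arc_two_subset : D.arc 1 ∩ D.arc 2 ⊆ {D.pt 2} := by
  rintro z ⟨h1z, h2z⟩
  obtain ⟨-, e1, e2⟩ := arcs_three D
  rw [e1] at h1z; rw [e2] at h2z
  obtain ⟨s, hs, rfl⟩ := h1z
  obtain ⟨t, ht, hst⟩ := h2z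
  have h0 := D.mark_mem 0; have h1 := D.mark_mem 1; have h2 := D.mark_mem 2
  obtain ⟨m01, m12, m20⟩ := marks_three D
  rw [mem_singleton_iff]
  rcases eq_or_eq_sub_one_of_boundary_eq D ⟨by linarith [hs.1, h1.1], by linarith [hs.2, h2.2]⟩
    (by linarith [ht.1, h2.1]) (by linarith [ht.2, h0.2]) hst.symm with h' | h'
  · have : s = D.mark 2 := le_antisymm hs.2 (h' ▸ ht.1)
    rw [this]; rfl
  · linarith [hs.1, ht.2]

/-- The distances of the marked points to the opposite arcs are positive. -/
theorem infDist_pt_arc_pos :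
    0 < infDist (D.pt 0) (D.arc 1) ∧ 0 < infDist (D.pt 1) (D.arc 2) ∧ 0 < infDist (D.pt 2) (D.arc 0) :=
  ⟨((D.isClosed_arc 1).notMem_iff_infDist_pos ⟨_, D.pt_mem_arc_self 1⟩).1 (pt_notMem_arcs D).1,
    ((D.isClosed_arc 2).notMem_iff_infDist_pos ⟨_, D.pt_mem_arc_self 2⟩).1 (pt_notMem_arcs D).2.2,
    ((D.isClosed_arc 0).notMem_iff_infDist_pos ⟨_, D.pt_mem_arc_self 0⟩).1 (pt_notMem_arcs D).2.1⟩

/-! ### Compactness: near all three arcs is impossible; near `α₁` and `α₂` means near `x₂` -/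

/-- Membership in a closed thickening of an arc from a bound on `infDist`. -/
theorem mem_cthickening_arc_of_infDist_le (i : Fin 3) {z : ℂ} {r : ℝ} (h : infDist z (D.arc i) ≤ r) :
    z ∈ cthickening r (D.arc i) := by
  obtain ⟨y, hy, hyd⟩ := (D.isCompact_arc i).exists_infDist_eq_dist ⟨_, D.pt_mem_arc_self i⟩ z
  exact mem_cthickening_of_dist_le z y r _ hy (hyd ▸ h)

/-- A point at `infDist` zero from a compact nonempty set lies in it. -/
theorem mem_of_infDist_le_zero {s : Set ℂ} (hs : IsCompact s) (hne : s.Nonempty) {z : ℂ}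
    (h : infDist z s ≤ 0) : z ∈ s := by
  rw [← hs.isClosed.closure_eq, mem_closure_iff_infDist_zero hne]
  exact le_antisymm h infDist_nonneg

/-- **No point is close to all three arcs.** -/
theorem exists_not_near_three_arcs : ∃ μ : ℝ, 0 < μ ∧ ∀ z : ℂ, infDist z (D.arc 0) ≤ μ →
    infDist z (D.arc 1) ≤ μ → infDist z (D.arc 2) ≤ μ → False := by
  set g : ℂ → ℝ := fun z => infDist z (D.arc 0) + infDist z (D.arc 1) + infDist z (D.arc 2) with hg
  have hgc : Continuous g :=
    ((continuous_infDist_pt _).add (continuous_infDist_pt _)).add (continuous_infDist_pt _)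
  have hne : ∀ i, (D.arc i).Nonempty := fun i => ⟨_, D.pt_mem_arc_self i⟩
  set K := cthickening 1 (D.arc 0) with hK
  have hKc : IsCompact K := (D.isCompact_arc 0).cthickening
  have hKne : K.Nonempty := ⟨D.pt 0, self_subset_cthickening _ (D.pt_mem_arc_self 0)⟩
  obtain ⟨z₀, hz₀, hmin⟩ := hKc.exists_isMinOn hKne hgc.continuousOn
  have hpos : 0 < g z₀ := by
    by_contra hle
    push Not at hle
    have h0 : infDist z₀ (D.arc 0) ≤ 0 := by simp only [hg] at hle; linarith [(infDist_nonneg : 0 ≤ infDist z₀ (D.arc 1)), (infDist_nonneg : 0 ≤ infDist z₀ (D.arc 2))]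
    have h1 : infDist z₀ (D.arc 1) ≤ 0 := by simp only [hg] at hle; linarith [(infDist_nonneg : 0 ≤ infDist z₀ (D.arc 0)), (infDist_nonneg : 0 ≤ infDist z₀ (D.arc 2))]
    have h2 : infDist z₀ (D.arc 2) ≤ 0 := by simp only [hg] at hle; linarith [(infDist_nonneg : 0 ≤ infDist z₀ (D.arc 0)), (infDist_nonneg : 0 ≤ infDist z₀ (D.arc 1))]
    have hm1 := mem_of_infDist_le_zero (D.isCompact_arc 1) (hne 1) h1
    have hm2 := mem_of_infDist_le_zero (D.isCompact_arc 2) (hne 2) h2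
    have hm0 := mem_of_infDist_le_zero (D.isCompact_arc 0) (hne 0) h0
    have : z₀ = D.pt 2 := arc_one_inter_arc_two_subset D ⟨hm1, hm2⟩
    exact (pt_notMem_arcs D).2.1 (this ▸ hm0)
  refine ⟨min (1 / 2) (g z₀ / 4), lt_min (by norm_num) (by linarith), fun z h0 h1 h2 => ?_⟩
  have hzK : z ∈ K := mem_cthickening_arc_of_infDist_le D 0 (h0.trans ((min_le_left _ _).trans (by norm_num)))
  have hgz : g z₀ ≤ g z := hmin hzK
  have : g z ≤ 3 * min (1 / 2) (g z₀ / 4) := by simp only [hg]; linarith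
  linarith [min_le_right (1 / 2 : ℝ) (g z₀ / 4)]

/-- **Points close to `α₁` and to `α₂` are close to `x₂`.** -/
theorem exists_near_pt_two_of_near_arcs {lam : ℝ} (hlam : 0 < lam) : ∃ θ : ℝ, 0 < θ ∧ ∀ z : ℂ,
    infDist z (D.arc 1) ≤ θ → infDist z (D.arc 2) ≤ θ → dist z (D.pt 2) < lam := by
  set g : ℂ → ℝ := fun z => infDist z (D.arc 1) + infDist z (D.arc 2) with hg
  have hgc : Continuous g := (continuous_infDist_pt _).add (continuous_infDist_pt _)
  have hne : ∀ i, (D.arc i).Nonempty := fun i => ⟨_, D.pt_mem_arc_self i⟩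
  set K := cthickening 1 (D.arc 1) ∩ {z | lam ≤ dist z (D.pt 2)} with hK
  have hKc : IsCompact K :=
    (D.isCompact_arc 1).cthickening.inter_right (isClosed_le continuous_const (continuous_id.dist continuous_const))
  rcases K.eq_empty_or_nonempty with hKe | hKne
  · refine ⟨1 / 2, by norm_num, fun z h1 _ => ?_⟩
    by_contra hz
    push Not at hz
    have : z ∈ K := ⟨mem_cthickening_arc_of_infDist_le D 1 (h1.trans (by norm_num)), hz⟩
    rw [hKe] at this
    exact this
  obtain ⟨z₀, hz₀, hmin⟩ := hKc.exists_isMinOn hKne hgc.continuousOn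
  have hpos : 0 < g z₀ := by
    by_contra hle
    push Not at hle
    have h1 : infDist z₀ (D.arc 1) ≤ 0 := by simp only [hg] at hle; linarith [(infDist_nonneg : 0 ≤ infDist z₀ (D.arc 2))]
    have h2 : infDist z₀ (D.arc 2) ≤ 0 := by simp only [hg] at hle; linarith [(infDist_nonneg : 0 ≤ infDist z₀ (D.arc 1))]
    have hm1 := mem_of_infDist_le_zero (D.isCompact_arc 1) (hne 1) h1
    have hm2 := mem_of_infDist_le_zero (D.isCompact_arc 2) (hne 2) h2
    have : z₀ = D.pt 2 := arc_one_inter_arc_two_subset D ⟨hm1, hm2⟩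
    have hz := hz₀.2
    rw [mem_setOf_eq, this, dist_self] at hz
    linarith
  refine ⟨min (1 / 2) (g z₀ / 3), lt_min (by norm_num) (by linarith), fun z h1 h2 => ?_⟩
  by_contra hz
  push Not at hz
  have hzK : z ∈ K := ⟨mem_cthickening_arc_of_infDist_le D 1 (h1.trans ((min_le_left _ _).trans (by norm_num))), hz⟩
  have hgz : g z₀ ≤ g z := hmin hzK
  have : g z ≤ 2 * min (1 / 2) (g z₀ / 3) := by simp only [hg]; linarith
  linarith [min_le_right (1 / 2 : ℝ) (g z₀ / 3)]

end Arcs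

/-! ### Two-edge sets whose midpoints are close to two far-apart points -/

/-- **Two edges, one near each point.** If a set of exactly two edges has its midpoints within
Hausdorff distance `< ε` of `{a, b}` with `2ε ≤ dist a b`, it consists of an edge with midpoint
within `ε` of `a` and an edge with midpoint within `ε` of `b`. -/
theorem exists_pair_of_hausdorffEDist_lt {δ ε : ℝ} {S : Set (Sym2 (Site 2))} (hS : S.ncard = 2)
    {a b : ℂ} (hab : 2 * ε ≤ dist a b)
    (hH : hausdorffEDist (medialPoint δ '' S) {a, b} < ENNReal.ofReal ε) :
    ∃ ea eb, S = {ea, eb} ∧ ea ≠ eb ∧ dist (medialPoint δ ea) a < ε ∧ dist (medialPoint δ eb) b < ε := by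
  have hH' : hausdorffEDist {a, b} (medialPoint δ '' S) < ENNReal.ofReal ε := by
    rwa [hausdorffEDist_comm]
  obtain ⟨_, ⟨ea, hea, rfl⟩, ha⟩ := exists_edist_lt_of_hausdorffEDist_lt (mem_insert a {b}) hH'
  obtain ⟨_, ⟨eb, heb, rfl⟩, hb⟩ :=
    exists_edist_lt_of_hausdorffEDist_lt (mem_insert_of_mem a (mem_singleton b)) hH'
  rw [edist_lt_ofReal, dist_comm] at ha hb
  have hne : ea ≠ eb := by
    rintro rfl
    linarith [dist_triangle a (medialPoint δ ea) b, dist_comm a (medialPoint δ ea)]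
  refine ⟨ea, eb, ?_, hne, ha, hb⟩
  refine Subset.antisymm (fun e he => ?_) ?_
  · obtain ⟨u, v, huv, rfl⟩ := Set.ncard_eq_two.1 hS
    simp only [Set.mem_insert_iff, Set.mem_singleton_iff] at hea heb he ⊢
    rcases hea with rfl | rfl <;> rcases heb with rfl | rfl <;> rcases he with rfl | rfl <;> tauto
  · rintro e (rfl | rfl)
    · exact hea
    · exact heb

/-! ### Registered sub-goal (one-line signature, verbatim) -/

/-- **Registered sub-goal `stub_discreteSplitting_geometry` of `stub_discreteSplitting`**: the metric
geometry of the three arcs of a `3`-marked Jordan domain (arcs of the chords, marked points off the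
opposite arcs, no point near all three arcs, near `α₁` and `α₂` means near `x₂`). -/
theorem stub_discreteSplitting_geometry : ∀ D : MarkedDomain 3, ((D.chord 0 2 (by decide)).arc 0 = D.arc 0 ∪ D.arc 1 ∧ (D.chord 0 2 (by decide)).arc 1 = D.arc 2) ∧ ((D.chord 1 2 (by decide)).arc 0 = D.arc 1 ∧ (D.chord 1 2 (by decide)).arc 1 = D.arc 2 ∪ D.arc 0) ∧ ((D.chord 0 1 (by decide)).arc 0 = D.arc 0 ∧ (D.chord 0 1 (by decide)).arc 1 = D.arc 1 ∪ D.arc 2) ∧ (0 < Metric.infDist (D.pt 0) (D.arc 1) ∧ 0 < Metric.infDist (D.pt 1) (D.arc 2) ∧ 0 < Metric.infDist (D.pt 2) (D.arc 0)) ∧ (∃ μ : ℝ, 0 < μ ∧ ∀ z : ℂ, Metric.infDist z (D.arc 0) ≤ μ → Metric.infDist z (D.arc 1) ≤ μ → Metric.infDist z (D.arc 2) ≤ μ → False) ∧ ∀ lam : ℝ, 0 < lam → ∃ θ : ℝ, 0 < θ ∧ ∀ z : ℂ, Metric.infDist z (D.arc 1) ≤ θ → Metric.infDist z (D.arc 2)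 ≤ θ → dist z (D.pt 2) < lam :=
  fun D => ⟨arc_chord_zero_two D, arc_chord_one_two D, arc_chord_zero_one D, infDist_pt_arc_pos D,
    exists_not_near_three_arcs D, fun _ hlam => exists_near_pt_two_of_near_arcs D hlam⟩

end Summit.CriticalPhenomena.CardyFormulaZ2.Cruxes.LagHandOff.HittingTournament

end
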